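import Mathlib
import Literature.Analysis.FluidPDE.CheskidovFriedlander2009.Reduction
import Literature.Topology.Euclidean.BrouwerAcuteAngle
import HarnessLib

/-!
# Cheskidov–Friedlander 2009, §2: existence of the viscous fixed point (Galerkin truncation and
# Brouwer's acute-angle lemma), and Thm. 4.2 reduced to Thm. 3.4 alone

Cheskidov–Friedlander, Physica D 238 (2009) 783–787 = arXiv:0810.3718v1, §2 p. 4: "The proof
of the existence of a solution to (2.1) follows from standard Navier–Stokes techniques in which
fixed point arguments are used for truncations of the system." This file carries that out for the
steady system of (1.2) in the original variables (`IsFixedPoint` of `VanishingViscosityLimit.lean`):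

* Galerkin step (`exists_galerkin`): for every `N` the truncated steady system (modes `0,…,N`,
  `α_{N+1} = 0`) has a solution with NON-NEGATIVE entries. The truncated residual with positive
  parts, `galerkinField` (so that zeros are automatically non-negative), is a continuous vector
  field on `ℝ^{N+1}` with `⟪G(ξ),ξ⟫ ≥ ν|ξ|² − f₀|ξ| ≥ 0` on the sphere `|ξ| = f₀/ν`
  (`sum_mul_galerkinField`: the flux pairs into non-negative brackets
  `(2^c)^i(ξ_i²ξ_{i+1}⁺ − (ξ_i⁺)²ξ_{i+1})`), so the acute-angle lemma
  `Literature.Topology.Euclidean.Brouwer.exists_zero_of_inner_nonneg_on_sphere` (Temam, Lemma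
  II.1.4) gives a zero;
* a priori bound (`galerkin_h1_le`): `νΣ_{j≤N}2^{2j}α_j² = f₀α₀`, hence `α_j ≤ (f₀/ν)2^{−j}`
  uniformly in `N`;
* compactness (`exists_isFixedPoint`): a subsequence converges coordinatewise (Tychonoff on
  `Π_j [0,(f₀/ν)2^{−j}]`), the limit solves every equation (each involves three coordinates) and
  is square-summable: an `ℓ²` (indeed `H¹`) fixed point with non-negative entries exists for every
  `c`, `ν > 0`, `f₀ > 0`;
* consequently (`CheskidovFriedlander2009_thm42_of_globalAttractor'`) the named fact
  `CheskidovFriedlander2009_thm42` (Thm. 4.2) follows from the named fact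
  `CheskidovFriedlander2009_globalAttractor` (Thm. 3.4, faithful form: non-negative fixed point)
  ALONE, and the hypothesis class of Thm. 3.4 is inhabited.  (The earlier variants
  `…_of_thm34` over the sign-free transcription were removed once refuted, see
  `NegativeFixedPoint.lean`.)

One definition (`galerkinField`, the positive-part Galerkin residual); no new facts.
-/

noncomputable section

open Set Filter Metric
open scoped BigOperators Topology

namespace Literature.Analysis.FluidPDE.CheskidovFriedlander2009

/-! ### The positive-part Galerkin residual -/

/-- The negated steady residual of (1.2) with positive parts on the neighbours:
`G_0(x) = νx₀ + x₀x₁⁺ − f₀`, `G_{j+1}(x) = ν2^{2(j+1)}x_{j+1} − (2^c)^j(x_j⁺)² + (2^c)^{j+1}x_{j+1}x_{j+2}⁺`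
(`x⁺ = max x 0`). On non-negative sequences it is `−rhs c ν (force f₀)`; its zeros are
automatically non-negative. The device is the standard one for Galerkin approximations of steady
Navier–Stokes-type systems. [cite: CheskidovFriedlander2009, §2 p.4 ("fixed point arguments are used for truncations of the system")]
[cite: Temam1979, Ch. II Lemma 1.4] -/
def galerkinField (c ν f₀ : ℝ) (x : ℕ → ℝ) : ℕ → ℝ
  | 0 => ν * x 0 + x 0 * max (x 1) 0 - f₀
  | j + 1 => ν * (2 : ℝ) ^ (2 * (j + 1)) * x (j + 1) - ((2 : ℝ) ^ c) ^ j * (max (x j) 0) ^ 2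
      + ((2 : ℝ) ^ c) ^ (j + 1) * x (j + 1) * max (x (j + 2)) 0

/-- On a non-negative sequence the Galerkin residual is `−rhs`. [cite: CheskidovFriedlander2009, §2 p.4] -/
theorem galerkinField_eq_neg_rhs (c ν f₀ : ℝ) {x : ℕ → ℝ} (hx : ∀ j, 0 ≤ x j) (j : ℕ) :
    galerkinField c ν f₀ x j = -rhs c ν (force f₀) x j := by
  cases j with
  | zero => simp only [galerkinField, rhs, force_zero, max_eq_left (hx 1)]; ring
  | succ j =>
    simp only [galerkinField, rhs, force_succ, max_eq_left (hx j), max_eq_left (hx (j + 2))]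
    ring

/-- The elementary bracket inequality behind coercivity: `0 ≤ a²b⁺ − (a⁺)²b`.
[cite: Temam1979, Ch. II Lemma 1.4] -/
theorem sq_mul_posPart_sub_nonneg (a b : ℝ) : 0 ≤ a ^ 2 * max b 0 - (max a 0) ^ 2 * b := by
  rcases le_or_gt 0 b with hb | hb
  · rw [max_eq_left hb]
    have : (max a 0) ^ 2 ≤ a ^ 2 := by
      rcases le_or_gt 0 a with ha | ha
      · rw [max_eq_left ha]
      · rw [max_eq_right ha.le]; nlinarith [sq_nonneg a]
    nlinarith
  · rw [max_eq_right hb.le, mul_zero, zero_sub, neg_nonneg]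
    exact mul_nonpos_of_nonneg_of_nonpos (sq_nonneg _) hb.le

/-- **The pairing identity**: `Σ_{i≤N} x_iG_i(x) = νΣ_{i≤N}2^{2i}x_i² − f₀x₀ +
Σ_{i<N}(2^c)^i(x_i²x_{i+1}⁺ − (x_i⁺)²x_{i+1}) + (2^c)^N x_N² x_{N+1}⁺` — the truncated energy
balance with positive parts. [cite: CheskidovFriedlander2009, Lemma 2.1 p.4 (energy identity of steady states)] -/
theorem sum_mul_galerkinField (c ν f₀ : ℝ) (x : ℕ → ℝ) (N : ℕ) :
    ∑ i ∈ Finset.range (N + 1), x i * galerkinField c ν f₀ x i =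
      ν * ∑ i ∈ Finset.range (N + 1), (2 : ℝ) ^ (2 * i) * x i ^ 2 - f₀ * x 0
        + ∑ i ∈ Finset.range N, ((2 : ℝ) ^ c) ^ i * (x i ^ 2 * max (x (i + 1)) 0
          - (max (x i) 0) ^ 2 * x (i + 1))
        + ((2 : ℝ) ^ c) ^ N * x N ^ 2 * max (x (N + 1)) 0 := by
  induction N with
  | zero =>
    simp only [zero_add, Finset.sum_range_one, galerkinField, Finset.range_zero, Finset.sum_empty,
      pow_zero, mul_zero, one_mul, add_zero]
    ring
  | succ N ih =>
    rw [Finset.sum_range_succ, ih, Finset.sum_range_succ _ (N + 1),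
      Finset.sum_range_succ (fun i => ((2 : ℝ) ^ c) ^ i * (x i ^ 2 * max (x (i + 1)) 0
        - (max (x i) 0) ^ 2 * x (i + 1))) N]
    simp only [galerkinField, show N + 1 + 1 = N + 2 from rfl]
    ring

/-- **Coercivity on sequences**: `Σ_{i≤N} x_iG_i(x) ≥ νΣ_{i≤N}x_i² − f₀x₀` for `ν ≥ 0`.
[cite: Temam1979, Ch. II Lemma 1.4] -/
theorem sum_mul_galerkinField_ge (c : ℝ) {ν : ℝ} (hν : 0 ≤ ν) (f₀ : ℝ) (x : ℕ → ℝ) (N : ℕ) :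
    ν * ∑ i ∈ Finset.range (N + 1), x i ^ 2 - f₀ * x 0 ≤
      ∑ i ∈ Finset.range (N + 1), x i * galerkinField c ν f₀ x i := by
  rw [sum_mul_galerkinField]
  have hL : (0 : ℝ) < (2 : ℝ) ^ c := Real.rpow_pos_of_pos two_pos c
  have h1 : ∑ i ∈ Finset.range (N + 1), x i ^ 2 ≤
      ∑ i ∈ Finset.range (N + 1), (2 : ℝ) ^ (2 * i) * x i ^ 2 :=
    Finset.sum_le_sum fun i _ =>
      le_mul_of_one_le_left (sq_nonneg _) (one_le_pow₀ (by norm_num))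
  have h2 : 0 ≤ ∑ i ∈ Finset.range N, ((2 : ℝ) ^ c) ^ i * (x i ^ 2 * max (x (i + 1)) 0
      - (max (x i) 0) ^ 2 * x (i + 1)) :=
    Finset.sum_nonneg fun i _ => mul_nonneg (pow_nonneg hL.le i) (sq_mul_posPart_sub_nonneg _ _)
  have h3 : 0 ≤ ((2 : ℝ) ^ c) ^ N * x N ^ 2 * max (x (N + 1)) 0 :=
    mul_nonneg (mul_nonneg (pow_nonneg hL.le N) (sq_nonneg _)) (le_max_right _ _)
  nlinarith

/-- **Zeros of the Galerkin residual are non-negative** (`ν > 0`, `f₀ ≥ 0`).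
[cite: Temam1979, Ch. II Lemma 1.4] -/
theorem nonneg_of_galerkinField_eq_zero {c ν f₀ : ℝ} (hν : 0 < ν) (hf : 0 ≤ f₀) {x : ℕ → ℝ}
    {j : ℕ} (h : galerkinField c ν f₀ x j = 0) : 0 ≤ x j := by
  have hL : (0 : ℝ) < (2 : ℝ) ^ c := Real.rpow_pos_of_pos two_pos c
  cases j with
  | zero =>
    simp only [galerkinField] at h
    -- `x₀ (ν + x₁⁺) = f₀ ≥ 0`
    have hcoef : 0 < ν + max (x 1) 0 := add_pos_of_pos_of_nonneg hν (le_max_right _ _)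
    by_contra hneg
    push Not at hneg
    have : x 0 * (ν + max (x 1) 0) < 0 := mul_neg_of_neg_of_pos hneg hcoef
    nlinarith
  | succ j =>
    simp only [galerkinField] at h
    -- `x_{j+1} (ν4^{j+1} + (2^c)^{j+1} x_{j+2}⁺) = (2^c)^j (x_j⁺)² ≥ 0`
    have hcoef : 0 < ν * (2 : ℝ) ^ (2 * (j + 1)) + ((2 : ℝ) ^ c) ^ (j + 1) * max (x (j + 2)) 0 :=
      add_pos_of_pos_of_nonneg (mul_pos hν (pow_pos two_pos _))
        (mul_nonneg (pow_nonneg hL.le _) (le_max_right _ _))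
    have hrhs : 0 ≤ ((2 : ℝ) ^ c) ^ j * (max (x j) 0) ^ 2 :=
      mul_nonneg (pow_nonneg hL.le _) (sq_nonneg _)
    by_contra hneg
    push Not at hneg
    have : x (j + 1) * (ν * (2 : ℝ) ^ (2 * (j + 1)) + ((2 : ℝ) ^ c) ^ (j + 1) * max (x (j + 2)) 0)
        < 0 := mul_neg_of_neg_of_pos hneg hcoef
    nlinarith

/-! ### The Galerkin step -/

/-- **Galerkin truncation** (the "truncations of the system" of §2): for every `N`, `ν > 0`,
`f₀ > 0` there is a sequence supported in `{0,…,N}`, with non-negative entries, solving the steady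
equations of (1.2) at the modes `0,…,N` (with `α_{N+1} = 0`). Proof: Brouwer's acute-angle lemma
for `galerkinField` on the ball of radius `f₀/ν` in `ℝ^{N+1}`.
[cite: CheskidovFriedlander2009, §2 p.4] [cite: Temam1979, Ch. II Lemma 1.4] -/
theorem exists_galerkin (c : ℝ) {ν f₀ : ℝ} (hν : 0 < ν) (hf : 0 < f₀) (N : ℕ) :
    ∃ x : ℕ → ℝ, (∀ j, 0 ≤ x j) ∧ (∀ j, N < j → x j = 0) ∧
      ∀ j, j ≤ N → rhs c ν (force f₀) x j = 0 := by
  -- the ambient Euclidean space and the extension-by-zero of coordinate vectors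
  let E := EuclideanSpace ℝ (Fin (N + 1))
  let ext : E → ℕ → ℝ := fun ξ j => if h : j < N + 1 then ξ ⟨j, h⟩ else 0
  have hext_lt : ∀ (ξ : E) (i : Fin (N + 1)), ext ξ i = ξ i := fun ξ i => by
    simp only [ext, dif_pos i.isLt]
  have hext_ge : ∀ (ξ : E) (j : ℕ), N < j → ext ξ j = 0 := fun ξ j hj => by
    simp only [ext, dif_neg (show ¬ j < N + 1 by omega)]
  have hext_cont : ∀ j : ℕ, Continuous fun ξ : E => ext ξ j := by
    intro j
    by_cases hj : j < N + 1
    · simp only [ext, dif_pos hj]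
      exact PiLp.continuous_apply 2 (fun _ : Fin (N + 1) => ℝ) ⟨j, hj⟩
    · simp only [ext, dif_neg hj]
      exact continuous_const
  -- the vector field
  let P : E → E := fun ξ => WithLp.toLp 2 fun i : Fin (N + 1) => galerkinField c ν f₀ (ext ξ) i
  have hPapply : ∀ (ξ : E) (i : Fin (N + 1)), P ξ i = galerkinField c ν f₀ (ext ξ) i :=
    fun ξ i => rfl
  have hGcont : ∀ j : ℕ, Continuous fun ξ : E => galerkinField c ν f₀ (ext ξ) j := by
    intro j
    cases j with
    | zero =>
      simp only [galerkinField]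
      exact (((continuous_const.mul (hext_cont 0)).add
        ((hext_cont 0).mul ((hext_cont 1).max continuous_const))).sub continuous_const)
    | succ j =>
      simp only [galerkinField]
      exact (((continuous_const.mul (hext_cont (j + 1))).sub
        (continuous_const.mul (((hext_cont j).max continuous_const).pow 2))).add
        ((continuous_const.mul (hext_cont (j + 1))).mul ((hext_cont (j + 2)).max continuous_const)))
  have hPcont : Continuous P :=
    (PiLp.continuous_toLp 2 (fun _ : Fin (N + 1) => ℝ)).comp (continuous_pi fun i => hGcont i)
  -- inner product and norm in coordinates
  have hinner : ∀ ξ : E, inner ℝ (P ξ) ξ =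
      ∑ i ∈ Finset.range (N + 1), ext ξ i * galerkinField c ν f₀ (ext ξ) i := by
    intro ξ
    rw [PiLp.inner_apply, ← Fin.sum_univ_eq_sum_range (fun i => ext ξ i * galerkinField c ν f₀ (ext ξ) i)]
    refine Finset.sum_congr rfl fun i _ => ?_
    rw [hPapply, hext_lt]
    simp
  have hnorm : ∀ ξ : E, ‖ξ‖ ^ 2 = ∑ i ∈ Finset.range (N + 1), ext ξ i ^ 2 := by
    intro ξ
    rw [EuclideanSpace.real_norm_sq_eq, ← Fin.sum_univ_eq_sum_range (fun i => ext ξ i ^ 2)]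
    exact Finset.sum_congr rfl fun i _ => by rw [hext_lt]
  have hcoord : ∀ ξ : E, ext ξ 0 ≤ ‖ξ‖ := by
    intro ξ
    have h1 : ext ξ 0 ^ 2 ≤ ‖ξ‖ ^ 2 := by
      rw [hnorm]
      exact Finset.single_le_sum (f := fun i => ext ξ i ^ 2) (fun i _ => sq_nonneg _)
        (Finset.mem_range.2 (Nat.succ_pos N))
    exact abs_le_of_sq_le_sq' h1 (norm_nonneg _) |>.2
  -- coercivity on the sphere of radius `R = f₀/ν`
  set R : ℝ := f₀ / ν with hR
  have hR0 : 0 < R := div_pos hf hν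
  have hsphere : ∀ ξ : E, ‖ξ‖ = R → 0 ≤ inner ℝ (P ξ) ξ := by
    intro ξ hξ
    rw [hinner]
    have h := sum_mul_galerkinField_ge c hν.le f₀ (ext ξ) N
    rw [← hnorm, hξ] at h
    have h0 := hcoord ξ
    rw [hξ] at h0
    have hνR : ν * R ^ 2 - f₀ * R = 0 := by rw [hR]; field_simp; ring
    nlinarith
  -- Brouwer
  obtain ⟨ξ, -, hzero⟩ :=
    Literature.Topology.Euclidean.Brouwer.exists_zero_of_inner_nonneg_on_sphere hR0
      hPcont.continuousOn hsphere
  refine ⟨ext ξ, ?_, hext_ge ξ, ?_⟩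
  · -- non-negativity: modes `≤ N` from the zero of the residual, the rest are `0`
    have hG : ∀ j, j ≤ N → galerkinField c ν f₀ (ext ξ) j = 0 := by
      intro j hj
      have := congrArg (fun v : E => v ⟨j, Nat.lt_succ_of_le hj⟩) hzero
      simpa [hPapply] using this
    intro j
    by_cases hj : j ≤ N
    · exact nonneg_of_galerkinField_eq_zero hν hf.le (hG j hj)
    · rw [hext_ge ξ j (by omega)]
  · intro j hj
    have hnn : ∀ k, 0 ≤ ext ξ k := by
      intro k
      by_cases hk : k ≤ N
      · have := congrArg (fun v : E => v ⟨k, Nat.lt_succ_of_le hk⟩) hzero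
        exact nonneg_of_galerkinField_eq_zero hν hf.le (by simpa [hPapply] using this)
      · rw [hext_ge ξ k (by omega)]
    have := congrArg (fun v : E => v ⟨j, Nat.lt_succ_of_le hj⟩) hzero
    have hG : galerkinField c ν f₀ (ext ξ) j = 0 := by simpa [hPapply] using this
    rw [galerkinField_eq_neg_rhs c ν f₀ hnn j] at hG
    linarith

/-! ### A priori bound, uniform in the truncation -/

/-- **The Galerkin energy identity and the uniform bound**: a solution of the truncated steady
system supported in `{0,…,N}` has `νΣ_{j≤N}2^{2j}x_j² = f₀x₀`, hence
`Σ_{j≤N}2^{2j}x_j² ≤ (f₀/ν)²`. [cite: CheskidovFriedlander2009, Lemma 2.1 p.4 (energy identity of steady states)] -/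
theorem galerkin_h1_le {c ν f₀ : ℝ} (hν : 0 < ν) (hf : 0 ≤ f₀) {N : ℕ} {x : ℕ → ℝ}
    (hsupp : ∀ j, N < j → x j = 0) (hsol : ∀ j, j ≤ N → rhs c ν (force f₀) x j = 0) :
    ∑ j ∈ Finset.range (N + 1), (2 : ℝ) ^ (2 * j) * x j ^ 2 ≤ (f₀ / ν) ^ 2 := by
  set D : ℝ := ∑ j ∈ Finset.range (N + 1), (2 : ℝ) ^ (2 * j) * x j ^ 2 with hD
  have hbal := sum_mul_rhs c ν (force f₀) x N
  have h0 : ∑ j ∈ Finset.range (N + 1), x j * rhs c ν (force f₀) x j = 0 :=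
    Finset.sum_eq_zero fun j hj => by
      rw [hsol j (Nat.lt_succ_iff.mp (Finset.mem_range.mp hj)), mul_zero]
  rw [h0, sum_force_mul, hsupp (N + 1) (Nat.lt_succ_self N), mul_zero, sub_zero] at hbal
  -- `ν D = f₀ x₀` and `x₀² ≤ D`
  have hνD : ν * D = f₀ * x 0 := by rw [hD]; linarith
  have hx0D : x 0 ^ 2 ≤ D := by
    have := Finset.single_le_sum (f := fun j => (2 : ℝ) ^ (2 * j) * x j ^ 2)
      (fun j _ => mul_nonneg (pow_nonneg zero_le_two _) (sq_nonneg _))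
      (Finset.mem_range.2 (Nat.succ_pos N))
    simpa using this
  have hK : 0 ≤ f₀ / ν := div_nonneg hf hν.le
  have hDK : D = f₀ / ν * x 0 := by
    field_simp
    linarith
  -- `x₀ ≤ f₀/ν`, so `D = (f₀/ν)x₀ ≤ (f₀/ν)²`
  have hx0 : x 0 ≤ f₀ / ν := by
    by_contra hlt
    push Not at hlt
    have hx0pos : 0 < x 0 := hK.trans_lt hlt
    have : f₀ / ν * x 0 < x 0 * x 0 := mul_lt_mul_of_pos_right hlt hx0pos
    nlinarith
  rw [hDK, sq]
  exact mul_le_mul_of_nonneg_left hx0 hK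

/-- Coordinatewise form of the uniform bound: `x_j ≤ (f₀/ν)/2^j` for every `j`.
[cite: CheskidovFriedlander2009, Lemma 2.1 p.4] -/
theorem galerkin_le {c ν f₀ : ℝ} (hν : 0 < ν) (hf : 0 ≤ f₀) {N : ℕ} {x : ℕ → ℝ}
    (hsupp : ∀ j, N < j → x j = 0) (hsol : ∀ j, j ≤ N → rhs c ν (force f₀) x j = 0) (j : ℕ) :
    x j ≤ f₀ / ν / (2 : ℝ) ^ j := by
  have hK : 0 ≤ f₀ / ν := div_nonneg hf hν.le
  by_cases hj : j ≤ N
  · have hD := galerkin_h1_le hν hf hsupp hsol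
    have hterm : (2 : ℝ) ^ (2 * j) * x j ^ 2 ≤ (f₀ / ν) ^ 2 :=
      (Finset.single_le_sum (f := fun i => (2 : ℝ) ^ (2 * i) * x i ^ 2)
        (fun i _ => mul_nonneg (pow_nonneg zero_le_two _) (sq_nonneg _))
        (Finset.mem_range.2 (Nat.lt_succ_of_le hj))).trans hD
    rw [le_div_iff₀ (pow_pos two_pos _)]
    have hsq : (x j * (2 : ℝ) ^ j) ^ 2 ≤ (f₀ / ν) ^ 2 := by
      calc (x j * (2 : ℝ) ^ j) ^ 2 = (2 : ℝ) ^ (2 * j) * x j ^ 2 := by ring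
        _ ≤ (f₀ / ν) ^ 2 := hterm
    exact (abs_le_of_sq_le_sq' hsq hK).2
  · rw [hsupp j (by omega)]
    positivity

/-! ### Passage to the limit `N → ∞` -/

/-- Each steady residual `rhs_j` is continuous in its three arguments: along a coordinatewise
convergent sequence of sequences, `rhs_j` converges. [cite: CheskidovFriedlander2009, §1 (1.2) p.2] -/
theorem tendsto_rhs_of_tendsto {c ν : ℝ} {f : ℕ → ℝ} {x : ℕ → ℕ → ℝ} {α : ℕ → ℝ}
    (h : ∀ j, Tendsto (fun n => x n j) atTop (𝓝 (α j))) (j : ℕ) :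
    Tendsto (fun n => rhs c ν f (x n) j) atTop (𝓝 (rhs c ν f α j)) := by
  cases j with
  | zero =>
    simp only [rhs]
    exact (((h 0).const_mul ν).neg.sub ((h 0).mul (h 1))).add tendsto_const_nhds
  | succ j =>
    simp only [rhs]
    exact ((((h (j + 1)).const_mul _).neg.add (((h j).pow 2).const_mul _)).sub
      ((((h (j + 1)).const_mul _).mul (h (j + 2))))).add tendsto_const_nhds

/-- **Existence of the viscous fixed point** (§2: "standard Navier–Stokes techniques … for
truncations of the system"), PROVED: for every exponent `c`, viscosity `ν > 0` and force `f₀ > 0`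
the steady system of (1.2) has an `ℓ²` solution with non-negative (hence positive,
`IsFixedPoint.pos`) entries, indeed with `α_j ≤ (f₀/ν)2^{−j}`. Galerkin solutions
(`exists_galerkin`), the uniform bound (`galerkin_le`), a coordinatewise convergent subsequence
(Tychonoff), and the limit in each of the (three-term) equations.
[cite: CheskidovFriedlander2009, §2 p.4] -/
theorem exists_isFixedPoint (c : ℝ) {ν f₀ : ℝ} (hν : 0 < ν) (hf : 0 < f₀) :
    ∃ α : ℕ → ℝ, IsFixedPoint c ν (force f₀) α ∧ (∀ j, 0 ≤ α j) ∧
      ∀ j, α j ≤ f₀ / ν / (2 : ℝ) ^ j := by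
  choose x hxnn hxsupp hxsol using fun N => exists_galerkin c hν hf N
  set K : ℝ := f₀ / ν with hK
  have hK0 : 0 ≤ K := div_nonneg hf.le hν.le
  have hxle : ∀ N j, x N j ≤ K / (2 : ℝ) ^ j := fun N j =>
    galerkin_le hν hf.le (hxsupp N) (hxsol N) j
  -- the compact box `Π_j [0, K/2^j]`
  set S : Set (ℕ → ℝ) := Set.pi Set.univ fun j => Icc 0 (K / (2 : ℝ) ^ j) with hS
  have hSc : IsCompact S := isCompact_univ_pi fun j => isCompact_Icc
  have hxS : ∀ N, x N ∈ S := fun N => fun j _ => ⟨hxnn N j, hxle N j⟩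
  obtain ⟨α, hαS, φ, hφ, hlim⟩ := hSc.tendsto_subseq hxS
  have hαj : ∀ j, 0 ≤ α j ∧ α j ≤ K / (2 : ℝ) ^ j := fun j => hαS j (Set.mem_univ j)
  have hconv : ∀ j, Tendsto (fun n => x (φ n) j) atTop (𝓝 (α j)) := fun j =>
    (tendsto_pi_nhds.1 hlim) j
  refine ⟨α, ⟨?_, fun j => ?_⟩, fun j => (hαj j).1, fun j => (hαj j).2⟩
  · -- square-summability from `α_j² ≤ K²(1/4)^j`
    have hgeom : Summable fun j : ℕ => K ^ 2 * (1 / 4 : ℝ) ^ j :=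
      (summable_geometric_of_lt_one (by norm_num) (by norm_num)).mul_left (K ^ 2)
    refine Summable.of_nonneg_of_le (fun j => sq_nonneg _) (fun j => ?_) hgeom
    have h1 := (hαj j).1
    have h2 := (hαj j).2
    have h3 : α j ^ 2 ≤ (K / (2 : ℝ) ^ j) ^ 2 := pow_le_pow_left₀ h1 h2 2
    calc α j ^ 2 ≤ (K / (2 : ℝ) ^ j) ^ 2 := h3
      _ = K ^ 2 * (1 / 4 : ℝ) ^ j := by
          rw [div_pow, ← pow_mul, one_div, inv_pow, show (4 : ℝ) = 2 ^ 2 by norm_num, ← pow_mul,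
            mul_comm 2 j]
          ring
  · -- the `j`-th equation: `rhs_j(x^{φ n}) = 0` as soon as `φ n ≥ j`, and it converges to `rhs_j(α)`
    have ht := tendsto_rhs_of_tendsto (c := c) (ν := ν) (f := force f₀) hconv j
    have hev : ∀ᶠ n in atTop, rhs c ν (force f₀) (x (φ n)) j = 0 := by
      refine eventually_atTop.2 ⟨j, fun n hn => hxsol (φ n) j ?_⟩
      exact hn.trans (hφ.id_le n)
    have h0 : Tendsto (fun n => rhs c ν (force f₀) (x (φ n)) j) atTop (𝓝 0) :=
      tendsto_const_nhds.congr' (hev.mono fun n hn => hn.symm)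
    exact tendsto_nhds_unique ht h0

/-! ### Consequences -/

/-- The hypothesis class of Thm. 3.4 is inhabited: for `c ∈ (3/2, 5/2]` (indeed any `c ≤ 3`),
`ν > 0`, `f₀ > 0` there is an `ℓ²` fixed point, positive, whose rescaling is a steady state of
`SteadyState.lean`; in particular `CheskidovFriedlander2009_globalAttractor` is not vacuously true.
[cite: CheskidovFriedlander2009, §2 p.4 and Thm 3.4 p.7] -/
theorem exists_isFixedPoint_isSteadyState {c ν f₀ : ℝ} (hc3 : c ≤ 3) (hν : 0 < ν) (hf : 0 < f₀) :
    ∃ α : ℕ → ℝ, IsFixedPoint c ν (force f₀) α ∧ (∀ j, 0 < α j) ∧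
      IsSteadyState (ν * (2 : ℝ) ^ (c / 6) / Real.sqrt f₀) ((2 : ℝ) ^ (2 - 2 * c / 3))
        (fun j => α j / inviscidFixedPoint c f₀ j) := by
  obtain ⟨α, hα, hnn, -⟩ := exists_isFixedPoint c hν hf
  exact ⟨α, hα, hα.pos hf hnn, hα.isSteadyState hc3 hν hf hnn⟩

/-- **Thm. 4.2 from Thm. 3.4 alone**: the named fact `CheskidovFriedlander2009_thm42` (the
vanishing-viscosity limit of the mean energy dissipation — Kolmogorov's zeroth law for the dyadic
model) follows from the named fact `CheskidovFriedlander2009_globalAttractor` (the global attractor), the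
existence of the fixed point being supplied by `exists_isFixedPoint`.
[cite: CheskidovFriedlander2009, Thm 4.2 pp.9–10] -/
theorem CheskidovFriedlander2009_thm42_of_globalAttractor' (h34 : CheskidovFriedlander2009_globalAttractor) :
    CheskidovFriedlander2009_thm42 :=
  CheskidovFriedlander2009_thm42_of_globalAttractor h34 fun c _ _ _ _ hν hf =>
    let ⟨α, hα, hnn, _⟩ := exists_isFixedPoint c hν hf
    ⟨α, hα, hnn⟩

/-- **The long-time mean dissipation at fixed viscosity, from Thm. 3.4**: for `c ∈ (3/2, 5/2]`,
`ν > 0`, `f₀ > 0` there is a number `L(ν)` — namely `f₀α^ν₀` for the fixed point `α^ν` — such that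
EVERY solution with non-negative datum has `T⁻¹∫₀ᵀ ν‖a‖²_{H¹} → L(ν)`, and moreover
`|L(ν) − ε_d| ≤ f₀·4·2^{c/3}ν` once `ν2^{c/6}f₀^{−1/2} ≤ 1/4` (quantitative zeroth law).
[cite: CheskidovFriedlander2009, Thm 4.2 pp.9–10] -/
theorem exists_meanDissipation_limit_of_globalAttractor (h34 : CheskidovFriedlander2009_globalAttractor) {c ν f₀ : ℝ}
    (hc : 3 / 2 < c) (hc' : c ≤ 5 / 2) (hν : 0 < ν) (hf : 0 < f₀) :
    ∃ L : ℝ, (∀ a : ℕ → ℝ → ℝ, IsSolution c ν (force f₀) a → (∀ j, 0 ≤ a j 0) →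
        Tendsto (meanDissipation ν a) atTop (𝓝 L)) ∧
      (ν * (2 : ℝ) ^ (c / 6) / Real.sqrt f₀ ≤ 1 / 4 →
        |L - epsilonD c f₀| ≤ f₀ * (4 * (2 : ℝ) ^ (c / 3)) * ν) := by
  obtain ⟨α, hα, hnn, -⟩ := exists_isFixedPoint c hν hf
  refine ⟨f₀ * α 0, fun a ha h0 => tendsto_meanDissipation_of_globalAttractor h34 hc hc' hν hf hα hnn ha h0,
    fun hμ => ?_⟩
  have h := hα.abs_apply_zero_sub_le hc (by linarith) hν hf hnn hμ
  rw [epsilonD, ← mul_sub, abs_mul, abs_of_pos hf]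
  calc f₀ * |α 0 - inviscidFixedPoint c f₀ 0| ≤ f₀ * (4 * (2 : ℝ) ^ (c / 3) * ν) :=
        mul_le_mul_of_nonneg_left h hf.le
    _ = f₀ * (4 * (2 : ℝ) ^ (c / 3)) * ν := by ring

end Literature.Analysis.FluidPDE.CheskidovFriedlander2009

end
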